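import Mathlib
import Literature.Algebra.EuclideanLattices.ConvexBodyLatticePoints
import Literature.Algebra.EuclideanLattices.BallGridPointsOverlap
import HarnessLib

/-!
# `MagicFunctionsPersist` (route LatticeMagic, item stmt-PneNP-2328), line `Sketch` — stub `stub_count`

Counting short integer vectors by cell packing: a finite set `S` of integer vectors
`z ∈ ℤⁿ` with `∑ zᵢ² ≤ r²` (`r > 0`) has at most `(1 + √n/r)ⁿ · vol B̄ⁿ(0, r)` elements.

Proof: the tree's upper half of the Micciancio–Goldwasser / Regev sandwich
(`Literature.Algebra.EuclideanLattices.card_mul_le_pow_mul_measureReal`) for the integer grid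
`ℤⁿ = scaledGrid n 1` (basis `gridBasis n _` with `L = 1`: cell radius `√n`, fundamental domain of
volume `1`) and the convex bounded body `S = B̄(0, r) ⊇ B̄(0, r)` gives
`#(B̄(0,r) ∩ ℤⁿ) ≤ (1 + √n/r)ⁿ vol B̄(0,r)`; the count of `B̄(0,r) ∩ ℤⁿ` is the count of integer
vectors `z` with `intVec z ∈ B̄(0,r)` (`card_inter_scaledGrid_one`), into which `S` injects.
-/

set_option linter.dupNamespace false -- `Summit.PneNP.PneNP.…`: summit = sub-problem (D-0017)

noncomputable section

open MeasureTheory Literature.Algebra.EuclideanLattices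

namespace Summit.PneNP.PneNP.Theorems.LatticeMagicMagicFunctionsPersist

/-- The points of `ℤⁿ = scaledGrid n 1` in a bounded set form a finite set, hence the integer
vectors `z` with `intVec z` in a bounded set form a finite type. -/
theorem finite_subtype_intVec_mem {n : ℕ} {A : Set (EuclideanSpace ℝ (Fin n))}
    (hA : Bornology.IsBounded A) : Finite {z : Fin n → ℤ // intVec n z ∈ A} := by
  have hfin : (A ∩ scaledGrid n 1).Finite := by
    rw [← coe_span_gridBasis n (one_ne_zero : (1 : ℝ) ≠ 0)]
    exact ZSpan.setFinite_inter _ hA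
  haveI := hfin.to_subtype
  exact Finite.of_equiv _ (intVecEquiv n A).symm

/-- **Cell-packing count for the integer grid.** The number of integer vectors in the closed ball
`B̄(0, r) ⊆ ℝⁿ` (`r > 0`) is at most `(1 + √n/r)ⁿ · vol B̄(0, r)`: the unit cells of these points are
disjoint, have volume `1`, and lie in `B̄(0, r) + B̄(0, √n) ⊆ (1 + √n/r) B̄(0, r)`. -/
theorem natCard_intVec_mem_closedBall_le {n : ℕ} {r : ℝ} (hr : 0 < r) :
    (Nat.card {z : Fin n → ℤ //
        intVec n z ∈ Metric.closedBall (0 : EuclideanSpace ℝ (Fin n)) r} : ℝ) ≤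
      (1 + Real.sqrt n / r) ^ n *
        volume.real (Metric.closedBall (0 : EuclideanSpace ℝ (Fin n)) r) := by
  have h1 : (1 : ℝ) ≠ 0 := one_ne_zero
  have hρ : ∀ x : EuclideanSpace ℝ (Fin n),
      ‖x - (ZSpan.floor (gridBasis n h1) x : EuclideanSpace ℝ (Fin n))‖ ≤ Real.sqrt n := fun x ↦ by
    simpa using norm_sub_floor_gridBasis_le n h1 x
  have hmain := card_mul_le_pow_mul_measureReal (gridBasis n h1) volume (ρ := Real.sqrt n)
    (Real.sqrt_nonneg _) hρ (convex_closedBall (0 : EuclideanSpace ℝ (Fin n)) r)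
    Metric.isBounded_closedBall hr subset_rfl
  rw [coe_span_gridBasis, volume_real_fundamentalDomain_gridBasis, abs_one, one_pow, inv_one,
    mul_one, finrank_euclideanSpace, Fintype.card_fin, card_inter_scaledGrid_one] at hmain
  exact hmain

/-- **Counting short integer vectors.** Any finite set of integer vectors of norm `≤ r` (`r > 0`)
in dimension `n ≥ 1` has at most `(1 + √n/r)ⁿ · vol B̄ⁿ(0, r)` elements (the unit cells of these
points lie in `B̄(0, r + √n)`, a homothetic copy of the ball; tree
`card_mul_le_pow_mul_measureReal` for the grid `ℤⁿ`). -/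
theorem stub_count {n : ℕ} (_hn : 0 < n) {r : ℝ} (hr : 0 < r) (S : Finset (Fin n → ℤ))
    (hS : ∀ z ∈ S, ∑ i, ((z i : ℤ) : ℝ) ^ 2 ≤ r ^ 2) :
    (S.card : ℝ) ≤ (1 + Real.sqrt n / r) ^ n *
      volume.real (Metric.closedBall (0 : EuclideanSpace ℝ (Fin n)) r) := by
  set B : Set (EuclideanSpace ℝ (Fin n)) := Metric.closedBall 0 r with hB
  -- every `z ∈ S` is an integer point of the ball
  have hmem : ∀ z ∈ S, intVec n z ∈ B := fun z hz ↦ by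
    rw [hB, mem_closedBall_zero_iff, ← pow_le_pow_iff_left₀ (norm_nonneg _) hr.le two_ne_zero,
      norm_intVec_sq]
    exact hS z hz
  -- inject `S` into the (finite) type of integer points of the ball
  haveI : Finite {z : Fin n → ℤ // intVec n z ∈ B} :=
    finite_subtype_intVec_mem Metric.isBounded_closedBall
  have hinj : Function.Injective
      (fun z : S => (⟨z.1, hmem z.1 z.2⟩ : {z : Fin n → ℤ // intVec n z ∈ B})) := by
    intro z z' h
    apply Subtype.ext
    simpa using congrArg Subtype.val h
  have hcard : S.card ≤ Nat.card {z : Fin n → ℤ // intVec n z ∈ B} := by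
    rw [← Nat.card_eq_finsetCard]
    exact Nat.card_le_card_of_injective _ hinj
  calc (S.card : ℝ) ≤ Nat.card {z : Fin n → ℤ // intVec n z ∈ B} := by exact_mod_cast hcard
    _ ≤ (1 + Real.sqrt n / r) ^ n * volume.real B := natCard_intVec_mem_closedBall_le hr

end Summit.PneNP.PneNP.Theorems.LatticeMagicMagicFunctionsPersist

end
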